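import Summits.HodgeConjecture.HodgeCM.PerL34.QautWedge_1

/-! PORT of `HodgeCM/PerL34/QautWedge.lean` (HodgeCMPerL run 81) — part 2: continuation of `Summits.HodgeConjecture.HodgeCM.PerL34.QautWedge_1` (split at a top-level declaration boundary by port_pkg.py; scope re-opened below; declarations unchanged). -/

-- port_pkg: scope re-opened for this part (file-level context, then the namespace/section stack open at the cut)
set_option autoImplicit false
noncomputable section
open MeasureTheory Complex Matrix
open scoped Pointwise
namespace HodgeCM
namespace PerL34
namespace Qaut
section Action
variable {K : Type*} [Group K]
variable {C : Type*} [NormedCommRing C] [NormedAlgebra ℂ C]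
variable {ρ : K →* Matrix (Fin 2) (Fin 2) ℂ} {σ : K →* (C →ₐ[ℂ] C)}
variable [MeasurableSpace K] (μ : Measure K)
variable {μ}
variable [TopologicalSpace K] [IsTopologicalGroup K] [BorelSpace K] [CompactSpace K]
  [IsProbabilityMeasure μ] [CompleteSpace C]
/-- the averaged tensor is of type `det`: `T(ρ g) (avg w) = det(ρ g) • avg w`. -/
theorem T_avg [μ.IsMulLeftInvariant] (hρc : Continuous fun k => ρ k) (hρ : ∀ k, IsUnit (ρ k).det)
    (g : K) (w : Fin 2 → Fin 2 → ℂ) : T (ρ g) (avg μ ρ w) = (ρ g).det • avg μ ρ w := by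
  rw [avg]
  have h1 : T (ρ g) (∫ k, ((ρ k).det)⁻¹ • T (ρ k) w ∂μ) =
      ∫ k, LinearMap.toContinuousLinearMap (T (ρ g)) (((ρ k).det)⁻¹ • T (ρ k) w) ∂μ := by
    rw [ContinuousLinearMap.integral_comp_comm _ (integrable_avg hρc hρ w),
      LinearMap.coe_toContinuousLinearMap']
  rw [h1]
  have h2 : (fun k => LinearMap.toContinuousLinearMap (T (ρ g)) (((ρ k).det)⁻¹ • T (ρ k) w)) =
      fun k => (fun k' => ((ρ (g⁻¹ * k')).det)⁻¹ • T (ρ k') w) (g * k) := by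
    funext k
    simp only [LinearMap.coe_toContinuousLinearMap', map_smul, ← T_mul, ← map_mul, inv_mul_cancel_left]
  rw [h2, integral_mul_left_eq_self (fun k' => ((ρ (g⁻¹ * k')).det)⁻¹ • T (ρ k') w) g]
  have h3 : (fun k' => ((ρ (g⁻¹ * k')).det)⁻¹ • T (ρ k') w) =
      fun k' => (ρ g).det • (((ρ k').det)⁻¹ • T (ρ k') w) := by
    funext k'
    rw [map_mul, Matrix.det_mul, det_inv_eq, mul_inv, inv_inv, smul_smul]
  rw [h3, integral_smul]

omit [CompactSpace K] [IsProbabilityMeasure μ] [CompleteSpace C] in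
/-- `pr ∘ σ k₀ = det(ρ k₀) • pr` (right-invariance of the Haar measure). -/
theorem pr_sigma [μ.IsMulRightInvariant] (hρ : ∀ k, IsUnit (ρ k).det) (k₀ : K) (c : C) :
    pr μ ρ σ (σ k₀ c) = (ρ k₀).det • pr μ ρ σ c := by
  rw [pr, pr, ← integral_smul]
  have h : (fun k => ((ρ k).det)⁻¹ • σ k (σ k₀ c)) =
      fun k => (fun k' => (ρ k₀).det • (((ρ k').det)⁻¹ • σ k' c)) (k * k₀) := by
    funext k
    simp only [map_mul, Matrix.det_mul, AlgHom.mul_apply, mul_inv, smul_smul]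
    congr 1
    rw [mul_left_comm, mul_inv_cancel₀ (det_ne_zero hρ k₀), mul_one]
  rw [h, integral_mul_right_eq_self (fun k' => (ρ k₀).det • (((ρ k').det)⁻¹ • σ k' c)) k₀]

omit [CompactSpace K] [IsProbabilityMeasure μ] [CompleteSpace C] in
/-- **The `U(1)`-weight count** (Lemma 3.5 proof, tex ll. 369–371: "the `\mathrm U(1)`-weight of `\kappa`
(`=-2`) … `\Rightarrow` only `n_1=n_2=1` survives"): if some `k₀ ∈ K` acts on `f₁, f₂` by scalars `c₁, c₂` with
`c₁ c₂ ≠ det ρ(k₀)`, then the `∧²𝔭₊`-projection of `f₁ f₂` vanishes.  (Which scalars occur — the `K_{ι₁}`-type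
list of `J⁺` — is the PRINT input [KV78]/[Adams] of pv08's `N19g_core`; given it, the surviving pair is
`pr_mul`'s setting.) -/
theorem pr_mul_eq_zero_of_weights [μ.IsMulRightInvariant] (hρ : ∀ k, IsUnit (ρ k).det) (k₀ : K)
    {f₁ f₂ : C} {c₁ c₂ : ℂ} (h₁ : σ k₀ f₁ = c₁ • f₁) (h₂ : σ k₀ f₂ = c₂ • f₂)
    (hne : c₁ * c₂ ≠ (ρ k₀).det) : pr μ ρ σ (f₁ * f₂) = 0 := by
  have h := pr_sigma (μ := μ) (σ := σ) hρ k₀ (f₁ * f₂)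
  rw [map_mul, h₁, h₂, smul_mul_smul_comm, pr_smul] at h
  have h' : (c₁ * c₂ - (ρ k₀).det) • pr μ ρ σ (f₁ * f₂) = 0 := by
    rw [sub_smul, h, sub_self]
  rcases smul_eq_zero.mp h' with h0 | h0
  · exact absurd (sub_eq_zero.mp h0) hne
  · exact h0

/-- **`pr` kills the symmetric part** (needs, in the image of `ρ`, a diagonal matrix with distinct entries and an
anti-diagonal matrix — a weight basis of `𝔭₊`, see `symTensor_eq_zero`). -/
theorem pr_sym_eq_zero [μ.IsMulLeftInvariant] (hρc : Continuous fun k => ρ k) (hρ : ∀ k, IsUnit (ρ k).det)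
    (h₁ : ∃ k s t, s ≠ t ∧ ρ k = !![s, 0; 0, t]) (h₂ : ∃ k a b, ρ k = !![0, a; b, 0])
    {u v : (Fin 2 → ℂ) →ₗ[ℂ] C} (hu : IsForm ρ σ u) (hv : IsForm ρ σ v) (x y : Fin 2 → ℂ) :
    pr μ ρ σ (u x * v y + u y * v x) = 0 := by
  rw [sym_eq_S, pr_S hρc hρ hu hv]
  set w : Fin 2 → Fin 2 → ℂ := fun i j => x i * y j + y i * x j with hw
  have hsym : tr w = w := by
    funext i j
    simp only [tr_apply, hw]
    ring
  have havg : avg μ ρ w = 0 := by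
    obtain ⟨k₁, s, t, hst, hk₁⟩ := h₁
    obtain ⟨k₂, a, b, hk₂⟩ := h₂
    have hd₁ : (!![s, 0; 0, t]).det ≠ 0 := by rw [← hk₁]; exact det_ne_zero hρ k₁
    have hd₂ : (!![0, a; b, 0]).det ≠ 0 := by rw [← hk₂]; exact det_ne_zero hρ k₂
    have hT₁ : T !![s, 0; 0, t] (avg μ ρ w) = (!![s, 0; 0, t]).det • avg μ ρ w := by
      rw [← hk₁]; exact T_avg hρc hρ k₁ w
    have hT₂ : T !![0, a; b, 0] (avg μ ρ w) = (!![0, a; b, 0]).det • avg μ ρ w := by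
      rw [← hk₂]; exact T_avg hρc hρ k₂ w
    refine symTensor_eq_zero _ ?_ hst hd₁ hT₁ hd₂ hT₂
    rw [tr_avg hρc hρ, hsym]
  rw [havg, map_zero]

/-- **MAIN (the converse of (eq:Qaut) on generators)**: `pr (u(x) v(y)) = ½ (x₀y₁ − x₁y₀) • (u ∧ v)`. -/
theorem pr_mul [μ.IsMulLeftInvariant] (hρc : Continuous fun k => ρ k) (hρ : ∀ k, IsUnit (ρ k).det)
    (hσ : ∀ c, Continuous fun k => σ k c)
    (h₁ : ∃ k s t, s ≠ t ∧ ρ k = !![s, 0; 0, t]) (h₂ : ∃ k a b, ρ k = !![0, a; b, 0])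
    {u v : (Fin 2 → ℂ) →ₗ[ℂ] C} (hu : IsForm ρ σ u) (hv : IsForm ρ σ v) (x y : Fin 2 → ℂ) :
    pr μ ρ σ (u x * v y) = ((x 0 * y 1 - x 1 * y 0) / 2) • wedge u v := by
  have hsplit : u x * v y =
      (1 / 2 : ℂ) • (u x * v y + u y * v x) + (1 / 2 : ℂ) • (u x * v y - u y * v x) := by
    rw [← smul_add]
    have : u x * v y + u y * v x + (u x * v y - u y * v x) = (2 : ℂ) • (u x * v y) := by
      rw [two_smul]; abel
    rw [this, smul_smul]
    norm_num
  rw [hsplit, pr_add hρc hρ hσ, pr_smul, pr_smul, pr_sym_eq_zero hρc hρ h₁ h₂ hu hv, smul_zero, zero_add,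
    alt_eq, pr_smul, pr_wedge hρ hu hv, smul_smul]
  congr 1
  ring

/-- **(eq:Qaut) proper**: the wedge is (twice) a projected product of components. -/
theorem wedge_eq_two_smul_pr [μ.IsMulLeftInvariant] (hρc : Continuous fun k => ρ k)
    (hρ : ∀ k, IsUnit (ρ k).det) (hσ : ∀ c, Continuous fun k => σ k c)
    (h₁ : ∃ k s t, s ≠ t ∧ ρ k = !![s, 0; 0, t]) (h₂ : ∃ k a b, ρ k = !![0, a; b, 0])
    {u v : (Fin 2 → ℂ) →ₗ[ℂ] C} (hu : IsForm ρ σ u) (hv : IsForm ρ σ v) :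
    wedge u v = (2 : ℂ) • pr μ ρ σ (u (e 0) * v (e 1)) := by
  rw [pr_mul hρc hρ hσ h₁ h₂ hu hv, smul_smul]
  simp [e_apply_ne (show (1 : Fin 2) ≠ 0 by decide), e_apply_ne (show (0 : Fin 2) ≠ 1 by decide)]

/-- **The converse of (eq:Qaut)** (tex ll. 255–256): for `f₁` in the span of the values of a family `U₁` of forms
and `f₂` in that of `U₂` (i.e. `f_j ∈ π_j[𝔭₊]`), `pr (f₁ f₂)` is a linear combination of wedges `u ∧ v`,
`u ∈ U₁`, `v ∈ U₂`. -/
theorem pr_mul_mem_span_wedge [μ.IsMulLeftInvariant] (hρc : Continuous fun k => ρ k)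
    (hρ : ∀ k, IsUnit (ρ k).det) (hσ : ∀ c, Continuous fun k => σ k c)
    (h₁ : ∃ k s t, s ≠ t ∧ ρ k = !![s, 0; 0, t]) (h₂ : ∃ k a b, ρ k = !![0, a; b, 0])
    (U₁ U₂ : Set ((Fin 2 → ℂ) →ₗ[ℂ] C)) (hU₁ : ∀ u ∈ U₁, IsForm ρ σ u) (hU₂ : ∀ v ∈ U₂, IsForm ρ σ v)
    {f₁ f₂ : C} (hf₁ : f₁ ∈ Submodule.span ℂ {c | ∃ u ∈ U₁, ∃ x, c = u x})
    (hf₂ : f₂ ∈ Submodule.span ℂ {c | ∃ v ∈ U₂, ∃ y, c = v y}) :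
    pr μ ρ σ (f₁ * f₂) ∈ Submodule.span ℂ {c | ∃ u ∈ U₁, ∃ v ∈ U₂, c = wedge u v} := by
  have hmul : f₁ * f₂ ∈ Submodule.span ℂ ({c | ∃ u ∈ U₁, ∃ x, c = u x} * {c | ∃ v ∈ U₂, ∃ y, c = v y}) := by
    rw [← Submodule.span_mul_span]
    exact Submodule.mul_mem_mul hf₁ hf₂
  rw [← prL_apply hρc hρ hσ]
  have hle : Submodule.map (prL (μ := μ) hρc hρ hσ)
      (Submodule.span ℂ ({c | ∃ u ∈ U₁, ∃ x, c = u x} * {c | ∃ v ∈ U₂, ∃ y, c = v y})) ≤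
      Submodule.span ℂ {c | ∃ u ∈ U₁, ∃ v ∈ U₂, c = wedge u v} := by
    rw [Submodule.map_span, Submodule.span_le]
    rintro _ ⟨c, hc, rfl⟩
    obtain ⟨a, ⟨u, hu, x, rfl⟩, b, ⟨v, hv, y, rfl⟩, rfl⟩ := Set.mem_mul.mp hc
    simp only [SetLike.mem_coe, prL_apply]
    rw [pr_mul hρc hρ hσ h₁ h₂ (hU₁ u hu) (hU₂ v hv)]
    exact Submodule.smul_mem _ _ (Submodule.subset_span ⟨u, hu, v, hv, rfl⟩)
  exact hle (Submodule.mem_map_of_mem hmul)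

end Action

end Qaut
end PerL34
end HodgeCM

end
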